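import Literature.AlgebraicGeometry.Motives.AbelianVarietyFrobeniusBlockLagrangian   -- ★ twin of ED. 1 f2b6c542f6c16a3d (re-homed, LEAD «M-72»; generic lane, director (R1); rf b82af069f0bb1ba1, pen LA7-plan (g4) #7)
import HarnessLib

/-! # F0_P6b_FrobeniusLagrangian — next ED. = SHIM (re-home).  The declarations now live in the namespace
`Literature.AlgebraicGeometry.Motives.AbelianVarietyFrobeniusBlockLagrangian`; this file only re-exports, under the old namespace, the head the ONE tree
consumer (`Lines/F0_P6b_WDock.lean` ED. 4: `open …F0P6bFrobeniusLagrangian` :116) references — `blockLagrangianFrobenius_holds` — plus the letter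
`BlockLagrangianFrobenius` for probes written against the old names.  After W-DOCK ED. 5 (★-import switch) this shim has 0 consumers.  HC_CM is proved
only modulo the 7 printed citations (2 remaining named inputs) until rung 0 closes; count-neutral (0 `sorry`, 0 socket, 0 new declaration). -/

set_option linter.dupNamespace false  -- `Summit.HodgeConjecture.HodgeConjecture.…` BY DESIGN (D-0017)
namespace Summit.HodgeConjecture.HodgeConjecture.Cruxes.HLiu418.F0P6bFrobeniusLagrangian
export Literature.AlgebraicGeometry.Motives.AbelianVarietyFrobeniusBlockLagrangian (BlockReduction BlockLagrangianFrobenius stub_BR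
  blockLagrangianFrobenius_of_line blockLagrangianFrobenius_holds)
end Summit.HodgeConjecture.HodgeConjecture.Cruxes.HLiu418.F0P6bFrobeniusLagrangian
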